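import Literature.NumberTheory.EllipticCurves.TianYuanZhang2017.CMPointSevenBlockValueDisplays
import HarnessLib

/-!
# Tian–Yuan–Zhang 2017 §3.1–3.2, the CM value (S4) — PROOFS companion of `CMPointSevenBlockValueDisplays`

THEOREMS ONLY (no definition, no named fact, no instance): the refinements `tyz_sevenBlockCMValueData ⟹ tyz_sevenBlockCMData ⟹
tyz_genusPointBlockData`, `SevenBlockCMValueSpec ⟹ SevenBlockCMSpec`; the arithmetic of TYZ's form `Q_{d,δ} = ((d+δ²)/4, δ, 1)`: its
discriminant is `−d`, it is a Heegner form of level `32` and discriminant `−d` in the tree's sense (`sevenBlockForm_mem_heegnerForms`), an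
admissible `δ` (`δ² ≡ −d (mod 128)`) EXISTS for every `d ≡ 7 (mod 8)` (`exists_dvd_add_sq_of_mod_eight`), its Heegner point is
`τ_{Q_{d,δ}} = (−δ + i√d)/((d+δ²)/2)` with `a·τ = (−δ + i√d)/2` (the generator `θ = aτ₀` of `𝒪_{K_d} = [1, aτ₀]` that the Shimura-reciprocity
display `ComplexMultiplication/ShimuraReciprocityExtendedRingClass.lean` consumes); and the kernel's reading of (S4) on coordinates,
`SevenBlockCMValue.exists_map_eq_some`: for `z = (x₀, y₀)`, `Dt.φ(τ_d) = (ȷ x₀, ȷ y₀)` — «`ȷ(x₀) = X(τ_d)`, `X = x ∘ i₀`».  Cell `bsd-print-cf2`,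
typer seat `-ty2` (g51), deliverable (A2) of the pen's SUMMON 2026-08-31T03:11:49Z for crux `stmt-BirchSwinnertonDyer-20509`.

References: [TianYuanZhang2017] Y. Tian, X. Yuan, S.-W. Zhang, *Genus periods, genus points and congruent number problem*, Asian J. Math. 21
(2017) = arXiv:1411.4728, §3.1 (p0010 L39, L47–L52, L85–L89); [Gross1984] B. H. Gross, *Heegner points on X₀(N)*, §I.1.
-/

noncomputable section

open scoped Classical

open WeierstrassCurve Complex

namespace Literature.NumberTheory.EllipticCurves.TianYuanZhang2017

/-! ## §1 The form `Q_{d,δ}` -/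

/-- The entries of `Q_{d,δ}`. [cite: TianYuanZhang2017, §3.1 (p0010 L47–L50)] -/
theorem sevenBlockForm_apply (d : ℕ) (δ : ℤ) :
    (sevenBlockForm d δ).1 = ((d : ℤ) + δ ^ 2) / 4 ∧ (sevenBlockForm d δ).2.1 = δ ∧ (sevenBlockForm d δ).2.2 = 1 :=
  ⟨rfl, rfl, rfl⟩

/-- `4·a = d + δ²` when `4 ∣ d + δ²`. [cite: TianYuanZhang2017, §3.1 (p0010 L47–L50)] -/
theorem four_mul_sevenBlockForm_fst {d : ℕ} {δ : ℤ} (h : (4 : ℤ) ∣ (d : ℤ) + δ ^ 2) :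
    4 * (sevenBlockForm d δ).1 = (d : ℤ) + δ ^ 2 := by
  rw [(sevenBlockForm_apply d δ).1]
  exact Int.mul_ediv_cancel' h

/-- The discriminant of `Q_{d,δ}` is `δ² − (d + δ²) = −d`. [cite: TianYuanZhang2017, §3.1 (p0010 L47–L50, L85–L88)] -/
theorem sevenBlockForm_discr {d : ℕ} {δ : ℤ} (h : (4 : ℤ) ∣ (d : ℤ) + δ ^ 2) :
    (sevenBlockForm d δ).2.1 ^ 2 - 4 * (sevenBlockForm d δ).1 * (sevenBlockForm d δ).2.2 = -(d : ℤ) := by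
  rw [(sevenBlockForm_apply d δ).2.2, mul_one, four_mul_sevenBlockForm_fst h, (sevenBlockForm_apply d δ).2.1]
  ring

/-- `128 ∣ d + δ²` gives `4 ∣ d + δ²`. [folklore] -/
private theorem four_dvd_of {d : ℕ} {δ : ℤ} (h : (128 : ℤ) ∣ (d : ℤ) + δ ^ 2) : (4 : ℤ) ∣ (d : ℤ) + δ ^ 2 :=
  (show (4 : ℤ) ∣ 128 by norm_num).trans h

/-- `32 ∣ a = (d + δ²)/4` when `128 ∣ d + δ²` («the embedding gives `𝒪̂_K^× ⊂ U₀(32)`»). [cite: TianYuanZhang2017, §3.1 (p0010 L50–L52)] -/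
theorem dvd_sevenBlockForm_fst {d : ℕ} {δ : ℤ} (h : (128 : ℤ) ∣ (d : ℤ) + δ ^ 2) : (32 : ℤ) ∣ (sevenBlockForm d δ).1 := by
  obtain ⟨k, hk⟩ := h
  refine ⟨k, ?_⟩
  have h4 := four_mul_sevenBlockForm_fst (four_dvd_of ⟨k, hk⟩)
  omega

/-- `a = (d + δ²)/4 > 0` for `d > 0`, `128 ∣ d + δ²`. [cite: TianYuanZhang2017, §3.1 (p0010 L47–L50)] -/
theorem sevenBlockForm_fst_pos {d : ℕ} (hd : 0 < d) {δ : ℤ} (h : (128 : ℤ) ∣ (d : ℤ) + δ ^ 2) : 0 < (sevenBlockForm d δ).1 := by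
  have h4 := four_mul_sevenBlockForm_fst (four_dvd_of h)
  have hδ : 0 ≤ δ ^ 2 := sq_nonneg δ
  have hd' : (0 : ℤ) < d := by exact_mod_cast hd
  omega

/-- **`Q_{d,δ}` is a Heegner form of level `32` and discriminant `−d`** (`heegnerForms 32 (−d)`: discriminant `−d`, `a > 0`, `32 ∣ a`,
primitive — here `c = 1`), for `d > 0` and `128 ∣ d + δ²`. [cite: TianYuanZhang2017, §3.1 (p0010 L47–L52, L85–L88)] [cite: Gross1984, §I.1] -/
theorem sevenBlockForm_mem_heegnerForms {d : ℕ} (hd : 0 < d) {δ : ℤ} (h : (128 : ℤ) ∣ (d : ℤ) + δ ^ 2) :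
    sevenBlockForm d δ ∈ heegnerForms 32 (-(d : ℤ)) := by
  refine ⟨sevenBlockForm_discr (four_dvd_of h), sevenBlockForm_fst_pos hd h, by exact_mod_cast dvd_sevenBlockForm_fst h,
    fun e _ _ he => ?_⟩
  rw [(sevenBlockForm_apply d δ).2.2] at he
  exact isUnit_of_dvd_one he

/-- The sixteen residues `r = 8k + 7 (mod 128)` each have a square root of `−r` modulo `128` (table, `decide`). [folklore] -/
private theorem exists_fin_sq (k : Fin 16) : ∃ δ : Fin 64, 128 ∣ (8 * (k : ℕ) + 7) + (δ : ℕ) ^ 2 := by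
  revert k
  decide +kernel

/-- **An admissible `δ` exists**: for `d ≡ 7 (mod 8)` there is `δ ∈ ℤ` with `δ² ≡ −d (mod 128)` («Here `δ` is an integer such that
`δ² ≡ −n (mod 128)`» — possible since `−n ≡ 1 (mod 8)`). [cite: TianYuanZhang2017, §3.1 (p0010 L50)] -/
theorem exists_dvd_add_sq_of_mod_eight {d : ℕ} (hd : d % 8 = 7) : ∃ δ : ℤ, (128 : ℤ) ∣ (d : ℤ) + δ ^ 2 := by
  have hr : d % 128 % 8 = 7 := by omega
  obtain ⟨δ, hδ⟩ := exists_fin_sq ⟨d % 128 / 8, by omega⟩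
  refine ⟨(δ : ℕ), ?_⟩
  have h1 : 8 * (d % 128 / 8) + 7 = d % 128 := by omega
  rw [Fin.val_mk, h1] at hδ
  have h2 : (128 : ℕ) ∣ d + (δ : ℕ) ^ 2 := by omega
  exact_mod_cast h2

/-- **The Heegner point of `Q_{d,δ}`** as a complex number: `τ_{Q_{d,δ}} = (−δ + i√d)/((d+δ²)/2)` — real part `−δ/(2a)`, imaginary part
`√(4a − δ²)/(2a) = √d/(2a)` with `a = (d+δ²)/4` — the fixed point `h` of `K_d^×`. [cite: TianYuanZhang2017, §3.1 (p0010 L85–L88)] [cite: Gross1984, §I.1] -/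
theorem coe_heegnerTau_sevenBlockForm {d : ℕ} (hd : 0 < d) {δ : ℤ} (h : (128 : ℤ) ∣ (d : ℤ) + δ ^ 2) :
    ((heegnerTau (sevenBlockForm d δ) : ℂ)) =
      ⟨-(δ : ℝ) / (2 * (sevenBlockForm d δ).1), √(d : ℝ) / (2 * (sevenBlockForm d δ).1)⟩ := by
  have hdisc := sevenBlockForm_discr (four_dvd_of h)
  have hneg : (sevenBlockForm d δ).2.1 ^ 2 - 4 * (sevenBlockForm d δ).1 * (sevenBlockForm d δ).2.2 < 0 := by
    rw [hdisc]; omega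
  rw [coe_heegnerTau (sevenBlockForm_fst_pos hd h) hneg]
  have h4 : (4 * (sevenBlockForm d δ).1 * (sevenBlockForm d δ).2.2 - (sevenBlockForm d δ).2.1 ^ 2 : ℝ) = d := by
    have := congrArg (fun z : ℤ => ((-z : ℤ) : ℝ)) hdisc
    simp only [neg_sub, Int.cast_sub, Int.cast_mul, Int.cast_pow, Int.cast_ofNat, neg_neg, Int.cast_natCast] at this
    exact this
  rw [h4, (sevenBlockForm_apply d δ).2.1]

/-- **`a·τ_{Q_{d,δ}} = (−δ + i√d)/2`**: the generator `θ = aτ₀` of `𝒪_{K_d} = [1, aτ₀]` (Cox §15's convention for `τ₀` a root of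
`ax² + bx + c`), `θ² + δθ + (d+δ²)/4 = 0`. [cite: TianYuanZhang2017, §3.1 (p0010 L85–L88)] [cite: Gross1984, §I.1] -/
theorem sevenBlockForm_fst_mul_coe_heegnerTau {d : ℕ} (hd : 0 < d) {δ : ℤ} (h : (128 : ℤ) ∣ (d : ℤ) + δ ^ 2) :
    ((sevenBlockForm d δ).1 : ℂ) * (heegnerTau (sevenBlockForm d δ) : ℂ) = (-(δ : ℂ) + I * (√(d : ℝ) : ℝ)) / 2 := by
  have ha : ((sevenBlockForm d δ).1 : ℂ) ≠ 0 := by exact_mod_cast (sevenBlockForm_fst_pos hd h).ne'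
  rw [coe_heegnerTau_sevenBlockForm hd h]
  apply Complex.ext
  · simp only [mul_re, intCast_re, intCast_im, zero_mul, sub_zero, div_ofNat_re, add_re, neg_re, I_re, I_im, ofReal_re,
      ofReal_im, mul_zero, add_zero]
    have ha' : ((sevenBlockForm d δ).1 : ℝ) ≠ 0 := by exact_mod_cast (sevenBlockForm_fst_pos hd h).ne'
    field_simp
  · simp only [mul_im, intCast_re, intCast_im, zero_mul, add_zero, div_ofNat_im, add_im, neg_im, I_re, I_im, ofReal_re,
      ofReal_im, mul_zero, one_mul, neg_zero, zero_add]
    have ha' : ((sevenBlockForm d δ).1 : ℝ) ≠ 0 := by exact_mod_cast (sevenBlockForm_fst_pos hd h).ne'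
    field_simp

/-! ## §2 (S4) on coordinates: «`ȷ(x₀) = X(τ_d)`» -/

namespace SevenBlockCMValue

variable {M : Type} [Field M] [CharZero M]

/-- **(S4) read on coordinates**: if `z = (x₀, y₀)` is the CM value of the block `d`, then for the data `(ȷ, δ, Dt)` it provides,
`Dt.φ(τ_{Q_{d,δ}})` is the affine point `(ȷ x₀, ȷ y₀)` of `A(ℂ)` — so `ȷ(x₀)` is the `x`-coordinate `X(τ_d)` of `A` along the degree-`1`
parametrisation `X₀(32) ⥲ A` at TYZ's Heegner point. [cite: TianYuanZhang2017, §3.1 (p0010 L39, L85–L89)] -/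
theorem exists_map_eq_some {x₀ y₀ : M} {h₀ : (curveA.baseChange M).toAffine.Nonsingular x₀ y₀} {d : ℕ}
    (h : SevenBlockCMValue (.some x₀ y₀ h₀) d) :
    ∃ (j : M →+* ℂ) (δ : ℤ) (Dt : ModularForms.ModularParametrizationData curveA 32)
      (hj : (curveA.baseChange ℂ).toAffine.Nonsingular (j x₀) (j y₀)),
      (128 : ℤ) ∣ (d : ℤ) + δ ^ 2 ∧ Dt.modularDegree = 1 ∧ Dt.φ (heegnerTau (sevenBlockForm d δ)) = .some (j x₀) (j y₀) hj := by
  obtain ⟨j, δ, Dt, hδ, hdeg, hz⟩ := h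
  rw [WeierstrassCurve.Affine.Point.map_some] at hz
  exact ⟨j, δ, Dt, _, hδ, hdeg, hz.symm⟩

/-- (S4) provides a Heegner form of level `32` and discriminant `−d` (for `d > 0`) at whose point `Dt.φ` takes the value `ȷ(z)`.
[cite: TianYuanZhang2017, §3.1 (p0010 L47–L52, L85–L89)] [cite: Gross1984, §I.1] -/
theorem exists_mem_heegnerForms {z : APoint M} {d : ℕ} (hd : 0 < d) (h : SevenBlockCMValue z d) :
    ∃ (j : M →+* ℂ) (Q : ℤ × ℤ × ℤ) (Dt : ModularForms.ModularParametrizationData curveA 32),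
      Q ∈ heegnerForms 32 (-(d : ℤ)) ∧ Q.2.2 = 1 ∧ Dt.modularDegree = 1 ∧
        WeierstrassCurve.Affine.Point.map (W' := curveA) j.toRatAlgHom z = Dt.φ (heegnerTau Q) := by
  obtain ⟨j, δ, Dt, hδ, hdeg, hz⟩ := h
  exact ⟨j, sevenBlockForm d δ, Dt, sevenBlockForm_mem_heegnerForms hd hδ, rfl, hdeg, hz⟩

end SevenBlockCMValue

/-! ## §3 The refinements -/

namespace GenusPointData

variable {n : ℕ}

/-- (S⁺) ⟹ (S): drop the value clause (S4). [cite: TianYuanZhang2017, §3.1 (p0011 L53–L58)] -/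
theorem SevenBlockCMValueSpec.sevenBlockCMSpec {D : GenusPointData n} {d : ℕ} (h : D.SevenBlockCMValueSpec d) :
    D.SevenBlockCMSpec d := by
  obtain ⟨M, _, _, _, ι, z, Φ, h1, h2, h3, -⟩ := h
  exact ⟨M, inferInstance, inferInstance, inferInstance, ι, z, Φ, h1, h2, h3⟩

/-- (S⁺) provides the value clause (S4) for its point. [cite: TianYuanZhang2017, §3.1 (p0010 L39, L85–L89)] -/
theorem SevenBlockCMValueSpec.exists_sevenBlockCMValue {D : GenusPointData n} {d : ℕ} (h : D.SevenBlockCMValueSpec d) :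
    ∃ (M : Type) (_ : Field M) (_ : NumberField M) (_ : IsGalois ℚ M) (_ : D.H →ₐ[ℚ] M) (z : APoint M), SevenBlockCMValue z d := by
  obtain ⟨M, _, _, _, ι, z, Φ, -, -, -, h4⟩ := h
  exact ⟨M, inferInstance, inferInstance, inferInstance, ι, z, h4⟩

/-- (S⁺) at every block ⟹ (S) at every block. [cite: TianYuanZhang2017, §3.1 (p0011 L53–L66)] -/
theorem SevenBlockCMValuePrinted.sevenBlockCMPrinted {D : GenusPointData n} (h : D.SevenBlockCMValuePrinted) :
    D.SevenBlockCMPrinted :=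
  fun d hd h7 => (h d hd h7).sevenBlockCMSpec

end GenusPointData

/-- **`tyz_sevenBlockCMValueData ⟹ tyz_sevenBlockCMData`** (drop (S4)). [cite: TianYuanZhang2017, §3.1, Thm. 3.5] -/
theorem tyz_sevenBlockCMData_of_sevenBlockCMValueData (h : tyz_sevenBlockCMValueData) : tyz_sevenBlockCMData :=
  fun n hsq h8 => by
    obtain ⟨D, hP, hC, hB, hS⟩ := h n hsq h8
    exact ⟨D, hP, hC, hB, hS.sevenBlockCMPrinted⟩

/-- `tyz_sevenBlockCMValueData ⟹ tyz_genusPointBlockData`. [cite: TianYuanZhang2017, §3.1, Thm. 3.5] -/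
theorem tyz_genusPointBlockData_of_sevenBlockCMValueData (h : tyz_sevenBlockCMValueData) : tyz_genusPointBlockData :=
  tyz_genusPointBlockData_of_sevenBlockCMData (tyz_sevenBlockCMData_of_sevenBlockCMValueData h)

end Literature.NumberTheory.EllipticCurves.TianYuanZhang2017

end
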